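import Summits.ABC.StewartYu.GenThreeFrameSpecTwo
import Summits.ABC.StewartYu.GenThreeFrameSpecOdd
import Summits.ABC.StewartYu.RecordExitC
import HarnessLib

/-!
# Cell abc-stewartyu, Gen-3 frames (cruxes `Y07Odd`/`Y07Two`): the RECORD predicates `RecordTwo` /
# `RecordOdd` from THREE scalar parameter inequalities (the matrix `M` eliminated)

`Summits/ABC/StewartYu/RecordAssembly.lean` — cell `abc-stewartyu` (HOME `run/shared/lean/pub/abc-stewartyu/`),
route `PadicPrimesKummerThird`, seat p4 (g3), engine-support seat; assembles `RecordExits.lean` (clauses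
(A), (B)) and `RecordExitC.lean` (clause (C)).  Theorems only, place-free apart from the `log p` summand of
the odd clause.

`GenThreeFrameSpecTwo.RecordTwo C n V Vmax W D₀ S₀ X D` and `GenThreeFrameSpecOdd.RecordOdd C p n V Vmax W D₀ S₀ X D`
quantify over all obstruction lattices (`r`, `d₀ ≤ 1`, integer matrices `M` with independent rows, column
selections `κ`).  By `RecordExits.clauseA_of_lt` / `clauseB_of_lt` / `P_le_Pmax` + `mul_log_mono` they
follow from three MATRIX-FREE inequalities in the parameters `(D₀, S₀, X, D)`, a uniform degree bound
`Dⱼ ≤ Dmax` and a Matveev-box constant `Λ` with `Dⱼ·Vⱼ ≤ Λ`: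

* (A) `∀ r ≤ n, d₀ ≤ 1: (n+1)!·2ⁿ·D₀·Dmax^r < choose(S₀+(r+1−d₀), r+1−d₀)·(2X+1)·(d₀+n−r)!·2^{n−r}·D₀^{d₀}`;
* (B) `∀ d₀ ≤ 1: (n+1)!·2ⁿ·D₀·∏ Dⱼ < choose(S₀+(n−d₀), n−d₀)·(2X+1)·d₀!·D₀^{d₀}`;
* (C) `∀ 0 < r < n, d₀ ≤ 1: C(r)·Pmax·(W + log 3 + log n + log Vmax + log Pmax [+ log p] + log 2Pmax) ≤ C(n)·∏V·(W [+ log p] + log 2Vmax)`,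
  `Pmax = (r!)²nʳ·((n+1)!·2ⁿ·D₀·Λʳ) / (choose(S₀+(r−d₀), r−d₀)·(2X+1)·(d₀+n−r)!·2^{n−r}·D₀^{d₀})`.

`recordTwo_of_ineqs` / `recordOdd_of_ineqs` are these implications.  So the record owner's (p1) deliverable
for `FrameTwo`/`FrameOdd` is: parameters as functions of the rank-`n` datum + three scalar inequalities +
the frame's extrapolation budget — exactly Nesterenko's (5.14)–(5.17), Lemma 5.4 and (5.22) as numerics.

WHAT THIS IS NOT: no choice of parameters, no numerics; no crux moves.

References: Yu. V. Nesterenko, LNM 1819 (2003), §5.2 (5.13)–(5.17), Lemma 5.4, (5.19)–(5.22).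
-/

noncomputable section

open Finset
open Literature.NumberTheory.Transcendental
open Literature.NumberTheory.Transcendental.GaGm

namespace Summit.ABC.StewartYu.RecordExits

open Summit.ABC.StewartYu.GenThreeFrameSpecTwo (RecordTwo)
open Summit.ABC.StewartYu.GenThreeFrameSpecOdd (RecordOdd)

variable {n : ℕ}

/-- **`RecordTwo` from three scalar inequalities** (clauses (A), (B) via `clauseA_of_lt`/`clauseB_of_lt`;
clause (C) via `P_le_Pmax`, `one_le_P` and the monotonicity `mul_log_mono`).
[cite: Nesterenko2003, §5.2 (5.14)–(5.17), Lemma 5.4, (5.22)] -/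
theorem recordTwo_of_ineqs {C : ℕ → ℝ} (hC : ∀ r, 0 ≤ C r) (hn : 1 ≤ n)
    {V : Fin n → ℝ} {Vmax W : ℝ} (hV1 : ∀ j, 1 ≤ V j) (hVmax1 : 1 ≤ Vmax) (hW : 0 ≤ W)
    {D₀ S₀ X Dmax : ℕ} {D : Fin n → ℕ} {Λ : ℝ}
    (hD₀ : 1 ≤ D₀) (hD1 : ∀ j, 1 ≤ D j) (hDmax : ∀ j, D j ≤ Dmax) (hΛ : ∀ j, (D j : ℝ) * V j ≤ Λ)
    (hA : ∀ r d₀ : ℕ, r ≤ n → d₀ ≤ 1 →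
      (n + 1).factorial * 2 ^ n * D₀ * Dmax ^ r <
        Nat.choose (S₀ + (r + 1 - d₀)) (r + 1 - d₀) * (2 * X + 1) *
          ((d₀ + (n - r)).factorial * 2 ^ (n - r) * D₀ ^ d₀))
    (hB : ∀ d₀ : ℕ, d₀ ≤ 1 →
      (n + 1).factorial * 2 ^ n * D₀ * ∏ j, D j <
        Nat.choose (S₀ + (n - d₀)) (n - d₀) * (2 * X + 1) * (d₀.factorial * D₀ ^ d₀))
    (hCineq : ∀ r d₀ : ℕ, 0 < r → r < n → d₀ ≤ 1 →
      C r * (((r.factorial : ℝ)) ^ 2 * (n : ℝ) ^ r *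
              ((((n + 1).factorial * 2 ^ n * D₀ : ℕ) : ℝ) * Λ ^ r /
                ((Nat.choose (S₀ + (r - d₀)) (r - d₀) * (2 * X + 1) *
                  ((d₀ + (n - r)).factorial * 2 ^ (n - r) * D₀ ^ d₀) : ℕ) : ℝ))) *
          (W + Real.log 3 + Real.log n + Real.log Vmax +
            Real.log (((r.factorial : ℝ)) ^ 2 * (n : ℝ) ^ r *
              ((((n + 1).factorial * 2 ^ n * D₀ : ℕ) : ℝ) * Λ ^ r /
                ((Nat.choose (S₀ + (r - d₀)) (r - d₀) * (2 * X + 1) *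
                  ((d₀ + (n - r)).factorial * 2 ^ (n - r) * D₀ ^ d₀) : ℕ) : ℝ))) +
            Real.log (2 * (((r.factorial : ℝ)) ^ 2 * (n : ℝ) ^ r *
              ((((n + 1).factorial * 2 ^ n * D₀ : ℕ) : ℝ) * Λ ^ r /
                ((Nat.choose (S₀ + (r - d₀)) (r - d₀) * (2 * X + 1) *
                  ((d₀ + (n - r)).factorial * 2 ^ (n - r) * D₀ ^ d₀) : ℕ) : ℝ))))) ≤
        C n * (∏ j, V j) * (W + Real.log (2 * Vmax))) :
    RecordTwo C n V Vmax W D₀ S₀ X D := by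
  refine ⟨clauseA_of_lt hD1 hDmax hA, clauseB_of_lt hD1 hB, ?_⟩
  intro r d₀ M hr0 hrn hd₀ _hM hineq κ hκ hdet
  have hV0 : ∀ j, 0 ≤ V j := fun j => by linarith [hV1 j]
  -- `P ≤ Pmax`, `1 ≤ P`
  have hPQ := P_le_Pmax M hD1 hV0 hΛ hD₀ hineq κ hκ
  have hP1 := one_le_P hn M hV1 κ hdet
  set P : ℝ := ((r.factorial : ℝ)) ^ 2 * (n : ℝ) ^ r *
      (|(Matrix.of fun i j => (M j (κ i) : ℝ)).det| * ∏ i, V (κ i)) with hPdef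
  set Q : ℝ := ((r.factorial : ℝ)) ^ 2 * (n : ℝ) ^ r *
      ((((n + 1).factorial * 2 ^ n * D₀ : ℕ) : ℝ) * Λ ^ r /
        ((Nat.choose (S₀ + (r - d₀)) (r - d₀) * (2 * X + 1) *
          ((d₀ + (n - r)).factorial * 2 ^ (n - r) * D₀ ^ d₀) : ℕ) : ℝ)) with hQdef
  -- `w = W + log 3 + log n + log Vmax ≥ 0`
  have hn1 : (1 : ℝ) ≤ n := by exact_mod_cast hn
  have hw : 0 ≤ W + Real.log 3 + Real.log n + Real.log Vmax := by
    have h3 : 0 ≤ Real.log 3 := Real.log_nonneg (by norm_num)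
    have h4 : 0 ≤ Real.log n := Real.log_nonneg hn1
    have h5 : 0 ≤ Real.log Vmax := Real.log_nonneg hVmax1
    linarith
  have hmono := mul_log_mono hw hP1 hPQ
  calc C r * P * (W + Real.log 3 + Real.log n + Real.log Vmax + Real.log P + Real.log (2 * P))
      = C r * (P * (W + Real.log 3 + Real.log n + Real.log Vmax + Real.log P + Real.log (2 * P))) := by
        ring
    _ ≤ C r * (Q * (W + Real.log 3 + Real.log n + Real.log Vmax + Real.log Q + Real.log (2 * Q))) :=
        mul_le_mul_of_nonneg_left hmono (hC r)
    _ = C r * Q * (W + Real.log 3 + Real.log n + Real.log Vmax + Real.log Q + Real.log (2 * Q)) := by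
        ring
    _ ≤ C n * (∏ j, V j) * (W + Real.log (2 * Vmax)) := hCineq r d₀ hr0 hrn hd₀

/-- **`RecordOdd` from three scalar inequalities** (as `recordTwo_of_ineqs`, with the `log p` summand;
`mul_log_mono'` with `E = log p ≥ 0`). [cite: Nesterenko2003, §5.2 (5.14)–(5.17), Lemma 5.4, (5.22)] -/
theorem recordOdd_of_ineqs {C : ℕ → ℝ} (hC : ∀ r, 0 ≤ C r) {p : ℕ} (hn : 1 ≤ n)
    {V : Fin n → ℝ} {Vmax W : ℝ} (hV1 : ∀ j, 1 ≤ V j) (hVmax1 : 1 ≤ Vmax) (hW : 0 ≤ W)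
    {D₀ S₀ X Dmax : ℕ} {D : Fin n → ℕ} {Λ : ℝ}
    (hD₀ : 1 ≤ D₀) (hD1 : ∀ j, 1 ≤ D j) (hDmax : ∀ j, D j ≤ Dmax) (hΛ : ∀ j, (D j : ℝ) * V j ≤ Λ)
    (hA : ∀ r d₀ : ℕ, r ≤ n → d₀ ≤ 1 →
      (n + 1).factorial * 2 ^ n * D₀ * Dmax ^ r <
        Nat.choose (S₀ + (r + 1 - d₀)) (r + 1 - d₀) * (2 * X + 1) *
          ((d₀ + (n - r)).factorial * 2 ^ (n - r) * D₀ ^ d₀))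
    (hB : ∀ d₀ : ℕ, d₀ ≤ 1 →
      (n + 1).factorial * 2 ^ n * D₀ * ∏ j, D j <
        Nat.choose (S₀ + (n - d₀)) (n - d₀) * (2 * X + 1) * (d₀.factorial * D₀ ^ d₀))
    (hCineq : ∀ r d₀ : ℕ, 0 < r → r < n → d₀ ≤ 1 →
      C r * (((r.factorial : ℝ)) ^ 2 * (n : ℝ) ^ r *
              ((((n + 1).factorial * 2 ^ n * D₀ : ℕ) : ℝ) * Λ ^ r /
                ((Nat.choose (S₀ + (r - d₀)) (r - d₀) * (2 * X + 1) *
                  ((d₀ + (n - r)).factorial * 2 ^ (n - r) * D₀ ^ d₀) : ℕ) : ℝ))) *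
          (W + Real.log 3 + Real.log n + Real.log Vmax +
            Real.log (((r.factorial : ℝ)) ^ 2 * (n : ℝ) ^ r *
              ((((n + 1).factorial * 2 ^ n * D₀ : ℕ) : ℝ) * Λ ^ r /
                ((Nat.choose (S₀ + (r - d₀)) (r - d₀) * (2 * X + 1) *
                  ((d₀ + (n - r)).factorial * 2 ^ (n - r) * D₀ ^ d₀) : ℕ) : ℝ))) +
            Real.log p +
            Real.log (2 * (((r.factorial : ℝ)) ^ 2 * (n : ℝ) ^ r *
              ((((n + 1).factorial * 2 ^ n * D₀ : ℕ) : ℝ) * Λ ^ r /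
                ((Nat.choose (S₀ + (r - d₀)) (r - d₀) * (2 * X + 1) *
                  ((d₀ + (n - r)).factorial * 2 ^ (n - r) * D₀ ^ d₀) : ℕ) : ℝ))))) ≤
        C n * (∏ j, V j) * (W + Real.log p + Real.log (2 * Vmax))) :
    RecordOdd C p n V Vmax W D₀ S₀ X D := by
  refine ⟨clauseA_of_lt hD1 hDmax hA, clauseB_of_lt hD1 hB, ?_⟩
  intro r d₀ M hr0 hrn hd₀ _hM hineq κ hκ hdet
  have hV0 : ∀ j, 0 ≤ V j := fun j => by linarith [hV1 j]
  have hPQ := P_le_Pmax M hD1 hV0 hΛ hD₀ hineq κ hκ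
  have hP1 := one_le_P hn M hV1 κ hdet
  set P : ℝ := ((r.factorial : ℝ)) ^ 2 * (n : ℝ) ^ r *
      (|(Matrix.of fun i j => (M j (κ i) : ℝ)).det| * ∏ i, V (κ i)) with hPdef
  set Q : ℝ := ((r.factorial : ℝ)) ^ 2 * (n : ℝ) ^ r *
      ((((n + 1).factorial * 2 ^ n * D₀ : ℕ) : ℝ) * Λ ^ r /
        ((Nat.choose (S₀ + (r - d₀)) (r - d₀) * (2 * X + 1) *
          ((d₀ + (n - r)).factorial * 2 ^ (n - r) * D₀ ^ d₀) : ℕ) : ℝ)) with hQdef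
  have hn1 : (1 : ℝ) ≤ n := by exact_mod_cast hn
  have hw : 0 ≤ W + Real.log 3 + Real.log n + Real.log Vmax := by
    have h3 : 0 ≤ Real.log 3 := Real.log_nonneg (by norm_num)
    have h4 : 0 ≤ Real.log n := Real.log_nonneg hn1
    have h5 : 0 ≤ Real.log Vmax := Real.log_nonneg hVmax1
    linarith
  have hE : 0 ≤ Real.log p := Real.log_natCast_nonneg p
  have hmono := mul_log_mono' hw hE hP1 hPQ
  calc C r * P * (W + Real.log 3 + Real.log n + Real.log Vmax + Real.log P + Real.log p + Real.log (2 * P))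
      = C r * (P * (W + Real.log 3 + Real.log n + Real.log Vmax + Real.log P + Real.log p +
          Real.log (2 * P))) := by ring
    _ ≤ C r * (Q * (W + Real.log 3 + Real.log n + Real.log Vmax + Real.log Q + Real.log p +
          Real.log (2 * Q))) := mul_le_mul_of_nonneg_left hmono (hC r)
    _ = C r * Q * (W + Real.log 3 + Real.log n + Real.log Vmax + Real.log Q + Real.log p +
          Real.log (2 * Q)) := by ring
    _ ≤ C n * (∏ j, V j) * (W + Real.log p + Real.log (2 * Vmax)) := hCineq r d₀ hr0 hrn hd₀

end Summit.ABC.StewartYu.RecordExits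

end
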